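import Summits.CriticalPhenomena.PercolationContinuityZ3.Theorems.SahiMasterFamilyZeroFamilies
import Summits.CriticalPhenomena.PercolationContinuityZ3.Theorems.SahiMasterFamilyLower
import Literature.Combinatorics.Sahi2008.UniformSquareAllOrders

/-!
# The lobe lemma: group separations inside a lobe of a cut vertex, and the cut-vertex faces of `E_k = 0` (all `k`)

Companion of `SahiMasterFamily.lean` / `SahiMasterFamilyLower.lean` / `SahiMasterFamilyZeroFamilies.lean` (crux
`NoHeavyLowerTail`, stmt-CriticalPhenomena-4575; unit `prim-masterthm-p4`).  The proved half of the master equality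
statement says `Z_k ⇒ E_k = 0` for every `k` (`sahiE_ind_eq_zero_of_suppZeroFlag`); its base is "two events determined by
DISJOINT sets of coordinates".  For the percolation rows (group separations `D[X|Y] = {X ↮ Y}` of a finite graph) this
file supplies the graph-theoretic input that turns the cell's "cut-vertex / lobe locus" into membership in `Z_k`:

* `IsLobe E W b` — every edge of the edge set `E ⊆ Sym2 V` joining `W` to its complement has its `W`-endpoint equal to
  `b` ("`W` is a lobe attached at `b`"; with no crossing edges at all, a union of components).
* `reachable_lobe` (THE LOBE LEMMA, configuration level): if the open edges form a lobe `W` at `b` then for `y ∈ W`: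
  a vertex `u ∈ W` is joined to `y` iff it is joined to `y` by open edges INSIDE `W`, and a vertex `u ∉ W` joined to
  `y` forces `b` to be joined to `y` inside `W` (walk surgery: every excursion leaves and re-enters through `b`).
* `determinedBy_groupSepVia_lobe`: hence the separation event "no open `E`-path from `X` to `Y`" (`groupSepVia E X Y`,
  `X, Y ⊆ W`) is DETERMINED BY the coordinates `E ∩ edgesIn W`; and `groupSepVia_subset_of_crossing`: a crossing
  separation `D_E[S|T]`, `S ⊆ X ⊆ W₁`, `T ⊆ Y ⊆ W₂`, CONTAINS `D_E[X|{b}]` and `D_E[{b}|Y]`.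
* Consequences for Sahi's functionals under ANY edge weights `w : Sym2 V → [0,1]` vanishing off `E` (the graph
  `(V, E)`; `sahiE_groupSep_eq_sahiE_groupSepVia`: then `E_k` of the true separations equals `E_k` of the `E`-separations,
  since the two indicator families agree on every configuration of positive weight):
  - `sahiE_groupSep_bouquet_eq_zero` — **bouquet face**: `k + 2` terminal pairs lying in `k + 2` lobes at a common
    vertex `b`, pairwise meeting only in `b` (loopless `E`): `E_{k+2}(D[X_0|Y_0],…,D[X_{k+1}|Y_{k+1}]) = 0`
    (`suppZeroFlag_of_pairwise_disjoint`);
  - `sahiE_groupSep_cutTerminal_eq_zero` — **cut-terminal face**: two lobes `W₁, W₂` at `b`, `X ⊆ W₁`, `Y ⊆ W₂`, and `m`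
    crossing pairs `S_j ⊆ X`, `T_j ⊆ Y`: `E_{m+2}(D[X|b], D[b|Y], D[S_1|T_1], …, D[S_m|T_m]) = 0` — the absorbing-pair
    family of the cell (`suppZeroFlag_absorbingPair`); at `m = 1` this is the named equality case "the terminal `b` is a
    cut vertex separating `X` from `Y`" of the rows `E1`/SHK3⁺ (run/shared/lean/prim/MASTER-FAMILY.md §1, 18:05Z).
Everything here is PROVED (no conjecture is used); the events are decreasing, so these are instances of the `⇐` half of
`MasterFamilyEqIffLower k`, now in graph language. [this work]
-/

noncomputable section

open scoped Classical

namespace Summit.CriticalPhenomena.PercolationContinuityZ3.Theorems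

open Finset Function
open Literature.Combinatorics.Sahi2008
open Literature.Probability.Percolation (BondConfig openGraph openGraph_adj DeterminedBy determinedBy_iff)
open Literature.Probability.Percolation.DecisionTree (ind ind_of_mem ind_of_not_mem ind_nonneg)

/-! ### Lobes of an edge set and the lobe lemma -/

section Lobe

variable {V : Type*}

/-- The edges (elements of `Sym2 V`) with both endpoints in `W`. [this work] -/
def edgesIn (W : Set V) : Set (Sym2 V) := {e | ∀ v ∈ e, v ∈ W}

/-- `s(u,v) ∈ edgesIn W ↔ u ∈ W ∧ v ∈ W`. [this work] -/
theorem mk_mem_edgesIn_iff {W : Set V} {u v : V} : s(u, v) ∈ edgesIn W ↔ u ∈ W ∧ v ∈ W := by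
  simp only [edgesIn, Set.mem_setOf_eq, Sym2.mem_iff, forall_eq_or_imp, forall_eq]

/-- **`W` is a lobe of the edge set `E` attached at `b`**: every edge of `E` from `W` to `V ∖ W` has its `W`-endpoint
equal to `b` (so `E`-paths can leave or enter `W` only through `b`). [this work] -/
def IsLobe (E : Set (Sym2 V)) (W : Set V) (b : V) : Prop :=
  ∀ u v : V, s(u, v) ∈ E → u ∈ W → v ∉ W → u = b

/-- A lobe of `E` is a lobe of every smaller edge set (in particular of every configuration `ω ⊆ E`). [this work] -/
theorem IsLobe.mono {E E' : Set (Sym2 V)} {W : Set V} {b : V} (h : IsLobe E W b) (hE : E' ⊆ E) : IsLobe E' W b :=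
  fun u v huv hu hv => h u v (hE huv) hu hv

/-- **The lobe lemma.**  If the open edge set `ω` is a lobe `W` at `b` and `y ∈ W`, then for every vertex `u` joined to
`y` by an open path: if `u ∈ W` it is joined to `y` by open edges inside `W`; if `u ∉ W` then `b` is joined to `y` by open
edges inside `W`. [this work] -/
theorem reachable_lobe {ω : BondConfig V} {W : Set V} {b : V} (hω : IsLobe ω W b) {y : V} (hy : y ∈ W) {u : V}
    (h : (openGraph ω).Reachable u y) :
    (u ∈ W → (openGraph (ω ∩ edgesIn W)).Reachable u y) ∧
      (u ∉ W → (openGraph (ω ∩ edgesIn W)).Reachable b y) := by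
  obtain ⟨p⟩ := h
  -- walk induction, the target `y` generalised to any vertex satisfying the conclusion
  suffices key : ∀ (u v : V) (_ : (openGraph ω).Walk u v),
      ((v ∈ W → (openGraph (ω ∩ edgesIn W)).Reachable v y) ∧
        (v ∉ W → (openGraph (ω ∩ edgesIn W)).Reachable b y)) →
      ((u ∈ W → (openGraph (ω ∩ edgesIn W)).Reachable u y) ∧
        (u ∉ W → (openGraph (ω ∩ edgesIn W)).Reachable b y)) from
    key u y p ⟨fun _ => SimpleGraph.Reachable.refl y, fun hy' => (hy' hy).elim⟩
  intro u v p
  induction p with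
  | nil => exact id
  | @cons u x v hadj p' ih =>
    intro hv
    obtain ⟨hx1, hx2⟩ := ih hv
    rw [openGraph_adj] at hadj
    obtain ⟨hux, hne⟩ := hadj
    by_cases hu : u ∈ W <;> by_cases hxW : x ∈ W
    · -- both endpoints inside: the edge is an inside edge
      refine ⟨fun _ => ?_, fun h => (h hu).elim⟩
      have hadj' : (openGraph (ω ∩ edgesIn W)).Adj u x := by
        rw [openGraph_adj]; exact ⟨⟨hux, mk_mem_edgesIn_iff.2 ⟨hu, hxW⟩⟩, hne⟩
      exact hadj'.reachable.trans (hx1 hxW)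
    · -- leaving `W`: `u = b`, and the excursion certifies `b ~ y` inside
      have hub : u = b := hω u x hux hu hxW
      refine ⟨fun _ => ?_, fun h => (h hu).elim⟩
      rw [hub]; exact hx2 hxW
    · -- entering `W` from outside: `x = b`
      have hxb : x = b := hω x u (Sym2.eq_swap ▸ hux) hxW hu
      refine ⟨fun h => (hu h).elim, fun _ => ?_⟩
      rw [← hxb]; exact hx1 hxW
    · exact ⟨fun h => (hu h).elim, fun _ => hx2 hxW⟩

/-- Inside a lobe, reachability equals reachability by inside edges. [this work] -/
theorem reachable_iff_reachable_inter_edgesIn {ω : BondConfig V} {W : Set V} {b : V} (hω : IsLobe ω W b) {x y : V}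
    (hx : x ∈ W) (hy : y ∈ W) :
    (openGraph ω).Reachable x y ↔ (openGraph (ω ∩ edgesIn W)).Reachable x y :=
  ⟨fun h => (reachable_lobe hω hy h).1 hx,
    fun h => h.mono (SimpleGraph.fromEdgeSet_mono Set.inter_subset_left)⟩

/-! ### Separation events that only use the edges of `E` -/

/-- The event "no open path from `X` to `Y` using only edges of `E`" — the group separation `D[X|Y]` of the graph
`(V, E)`, as an event on the full configuration space `Set (Sym2 V)` (coordinates off `E` are dummies). [this work] -/
def groupSepVia (E : Set (Sym2 V)) (X Y : Set V) : Set (BondConfig V) :=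
  {ω | ∀ x ∈ X, ∀ y ∈ Y, ¬ (openGraph (ω ∩ E)).Reachable x y}

/-- `groupSepVia` is a decreasing event. [this work] -/
theorem isLowerSet_groupSepVia (E : Set (Sym2 V)) (X Y : Set V) : IsLowerSet (groupSepVia E X Y) := by
  intro ω ω' hle hω x hx y hy h
  exact hω x hx y hy (h.mono (SimpleGraph.fromEdgeSet_mono (Set.inter_subset_inter_left E hle)))

/-- **Separations inside a lobe are determined by the lobe's edges**: if `W` is a lobe of `E` at `b` and `X, Y ⊆ W`,
then `D_E[X|Y]` is determined by the coordinates `E ∩ edgesIn W`. [this work] -/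
theorem determinedBy_groupSepVia_lobe {E : Set (Sym2 V)} {W : Set V} {b : V} (hE : IsLobe E W b) {X Y : Set V}
    (hX : X ⊆ W) (hY : Y ⊆ W) : DeterminedBy (groupSepVia E X Y) (E ∩ edgesIn W) := by
  rw [determinedBy_iff]
  intro ω ω' hωω'
  have key : ∀ ω₁ ω₂ : Set (Sym2 V), ω₁ ∩ (E ∩ edgesIn W) = ω₂ ∩ (E ∩ edgesIn W) →
      ω₂ ∈ groupSepVia E X Y → ω₁ ∈ groupSepVia E X Y := by
    intro ω₁ ω₂ h12 h2 x hx y hy hr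
    have hl1 : IsLobe (ω₁ ∩ E) W b := hE.mono Set.inter_subset_right
    have hl2 : IsLobe (ω₂ ∩ E) W b := hE.mono Set.inter_subset_right
    rw [reachable_iff_reachable_inter_edgesIn hl1 (hX hx) (hY hy), Set.inter_assoc, h12, ← Set.inter_assoc,
      ← reachable_iff_reachable_inter_edgesIn hl2 (hX hx) (hY hy)] at hr
    exact h2 x hx y hy hr
  exact ⟨key ω' ω hωω'.symm, key ω ω' hωω'⟩

/-- **Crossing separations absorb the half-separation at the attachment vertex.**  If `W` is a lobe of `E` at `b`,
`S ⊆ X ⊆ W` and `T` meets `W` at most in `b`, then `D_E[X|{b}] ⊆ D_E[S|T]` (an open `E`-path from `S` to `T` passes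
through `b`, by the lobe lemma). [this work] -/
theorem groupSepVia_subset_of_crossing {E : Set (Sym2 V)} {W : Set V} {b : V} (hE : IsLobe E W b) {X S T : Set V}
    (hX : X ⊆ W) (hS : S ⊆ X) (hT : ∀ t ∈ T, t ∈ W → t = b) :
    groupSepVia E X {b} ⊆ groupSepVia E S T := by
  intro ω hω s hs t ht hr
  have hl : IsLobe (ω ∩ E) W b := hE.mono Set.inter_subset_right
  -- reverse the path: from `t` to `s ∈ W`
  have key := reachable_lobe hl (hX (hS hs)) hr.symm
  by_cases htW : t ∈ W
  · have htb : t = b := hT t ht htW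
    have h1 := key.1 htW
    rw [htb] at h1
    exact hω s (hS hs) b rfl (h1.mono (SimpleGraph.fromEdgeSet_mono Set.inter_subset_left)).symm
  · have h2 := key.2 htW
    exact hω s (hS hs) b rfl (h2.mono (SimpleGraph.fromEdgeSet_mono Set.inter_subset_left)).symm

/-- The mirror statement: `D_E[{b}|Y] ⊆ D_E[S|T]` for `T ⊆ Y ⊆ W₂` (a lobe at `b`) and `S` off `W₂ ∖ {b}`. [this work] -/
theorem groupSepVia_subset_of_crossing' {E : Set (Sym2 V)} {W : Set V} {b : V} (hE : IsLobe E W b) {Y S T : Set V}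
    (hY : Y ⊆ W) (hT : T ⊆ Y) (hS : ∀ s ∈ S, s ∈ W → s = b) :
    groupSepVia E {b} Y ⊆ groupSepVia E S T := by
  intro ω hω s hs t ht hr
  have hl : IsLobe (ω ∩ E) W b := hE.mono Set.inter_subset_right
  have key := reachable_lobe hl (hY (hT ht)) hr
  by_cases hsW : s ∈ W
  · have hsb : s = b := hS s hs hsW
    have h1 := key.1 hsW
    rw [hsb] at h1
    exact hω b rfl t (hT ht) (h1.mono (SimpleGraph.fromEdgeSet_mono Set.inter_subset_left))
  · exact hω b rfl t (hT ht) ((key.2 hsW).mono (SimpleGraph.fromEdgeSet_mono Set.inter_subset_left))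

end Lobe

/-! ### Transfer to the true separations under weights vanishing off `E` -/

section Transfer

variable {V : Type} [Fintype V]

omit [Fintype V] in
/-- The tree's group separation event `D[X|Y] = {X ↮ Y}` (all of `Sym2 V` as coordinates) is `groupSepVia univ`.
[this work] -/
theorem groupSepVia_univ (X Y : Set V) :
    groupSepVia (Set.univ : Set (Sym2 V)) X Y =
      {ω : BondConfig V | ∀ x ∈ X, ∀ y ∈ Y, ¬ (openGraph ω).Reachable x y} := by
  ext ω; simp only [groupSepVia, Set.inter_univ, Set.mem_setOf_eq]

/-- A configuration using an edge of weight `0` has weight `0`. [folklore] -/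
theorem bernoulliWeight_eq_zero_of_mem {w : Sym2 V → unitInterval} {e : Sym2 V} (he : (w e : ℝ) = 0)
    {ω : BondConfig V} (heω : e ∈ ω) : bernoulliWeight w ω = 0 := by
  unfold bernoulliWeight Literature.Probability.Percolation.BHK2006.weight
  exact Finset.prod_eq_zero (Finset.mem_univ e) (by simp only [if_pos heω]; exact he)

/-- Under weights vanishing off `E`, every configuration of nonzero weight lies inside `E`. [folklore] -/
theorem subset_of_bernoulliWeight_ne_zero {w : Sym2 V → unitInterval} {E : Set (Sym2 V)}
    (hw : ∀ e ∉ E, (w e : ℝ) = 0) {ω : BondConfig V} (hω : bernoulliWeight w ω ≠ 0) : ω ⊆ E := by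
  intro e he
  by_contra heE
  exact hω (bernoulliWeight_eq_zero_of_mem (hw e heE) he)

/-- **`E_k` of the true separations = `E_k` of the `E`-separations** when the weights vanish off `E` (the two indicator
families agree on every configuration of nonzero weight, hence have the same joint moments; `sahiE_congr_of_moments`).
[this work] -/
theorem sahiE_groupSep_eq_sahiE_groupSepVia (w : Sym2 V → unitInterval) {E : Set (Sym2 V)}
    (hw : ∀ e ∉ E, (w e : ℝ) = 0) {k : ℕ} (X Y : Fin k → Set V) :
    sahiE (bernoulliWeight w) k
        (fun j => ind {ω : BondConfig V | ∀ x ∈ X j, ∀ y ∈ Y j, ¬ (openGraph ω).Reachable x y}) =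
      sahiE (bernoulliWeight w) k (fun j => ind (groupSepVia E (X j) (Y j))) := by
  refine sahiE_congr_of_moments _ _ k _ _ fun S _ => ?_
  simp only [ex]
  refine Finset.sum_congr rfl fun ω _ => ?_
  by_cases hω : bernoulliWeight w ω = 0
  · rw [hω, zero_mul, zero_mul]
  · have hωE : ω ∩ E = ω := Set.inter_eq_left.2 (subset_of_bernoulliWeight_ne_zero hw hω)
    congr 1
    simp only [Finset.prod_apply]
    refine Finset.prod_congr rfl fun j _ => ?_
    have hiff : ω ∈ {ω : BondConfig V | ∀ x ∈ X j, ∀ y ∈ Y j, ¬ (openGraph ω).Reachable x y} ↔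
        ω ∈ groupSepVia E (X j) (Y j) := by
      simp only [groupSepVia, Set.mem_setOf_eq, hωE]
    by_cases h1 : ω ∈ groupSepVia E (X j) (Y j)
    · rw [ind_of_mem h1, ind_of_mem (hiff.2 h1)]
    · rw [ind_of_not_mem h1, ind_of_not_mem fun h => h1 (hiff.1 h)]

end Transfer

/-! ### The cut-vertex faces of `E_k = 0`, every `k` -/

section Faces

variable {V : Type} [Fintype V]

/-- Finite determining sets: `D_E[X|Y]` for `X, Y` inside a lobe `W` is determined by the FINSET of coordinates
`E ∩ edgesIn W`. [this work] -/
theorem determinedBy_groupSepVia_lobe_toFinset {E : Set (Sym2 V)} {W : Set V} {b : V} (hE : IsLobe E W b)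
    {X Y : Set V} (hX : X ⊆ W) (hY : Y ⊆ W) :
    DeterminedBy (groupSepVia E X Y) (↑((E ∩ edgesIn W).toFinite.toFinset) : Set (Sym2 V)) := by
  rw [Set.Finite.coe_toFinset]; exact determinedBy_groupSepVia_lobe hE hX hY

/-- Lobes at a common vertex meeting only in `b` have disjoint inside-edge sets once `E` is loopless. [this work] -/
theorem disjoint_edgesIn_of_inter_subset {E : Set (Sym2 V)} (hE : ∀ e ∈ E, ¬ e.IsDiag) {W₁ W₂ : Set V} {b : V}
    (h : W₁ ∩ W₂ ⊆ {b}) :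
    Disjoint (E ∩ edgesIn W₁).toFinite.toFinset (E ∩ edgesIn W₂).toFinite.toFinset := by
  rw [Finset.disjoint_left]
  intro e h1 h2
  rw [Set.Finite.mem_toFinset] at h1 h2
  induction e using Sym2.ind with
  | h u v =>
    have hu : u = b := h ⟨(mk_mem_edgesIn_iff.1 h1.2).1, (mk_mem_edgesIn_iff.1 h2.2).1⟩
    have hv : v = b := h ⟨(mk_mem_edgesIn_iff.1 h1.2).2, (mk_mem_edgesIn_iff.1 h2.2).2⟩
    exact hE _ h1.1 (by rw [hu, hv]; exact Sym2.mk_isDiag_iff.2 rfl)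

/-- **Bouquet face (all orders).**  Let `E` be a loopless edge set, `b` a vertex and `W_0,…,W_{k+1}` lobes of `E` at `b`
meeting pairwise only in `b`; let the terminal pairs satisfy `X_j, Y_j ⊆ W_j`.  Then for every edge weight `w` vanishing off
`E`, `E_{k+2}(D[X_0|Y_0], …, D[X_{k+1}|Y_{k+1}]) = 0` (the separations are determined by pairwise disjoint edge sets, a
zero flag by `suppZeroFlag_of_pairwise_disjoint`). [this work] -/
theorem sahiE_groupSep_bouquet_eq_zero (w : Sym2 V → unitInterval) {E : Set (Sym2 V)} (hloop : ∀ e ∈ E, ¬ e.IsDiag)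
    (hw : ∀ e ∉ E, (w e : ℝ) = 0) {k : ℕ} (b : V) (W : Fin (k + 2) → Set V) (hW : ∀ j, IsLobe E (W j) b)
    (hWW : ∀ i j, i ≠ j → W i ∩ W j ⊆ {b}) (X Y : Fin (k + 2) → Set V) (hX : ∀ j, X j ⊆ W j)
    (hY : ∀ j, Y j ⊆ W j) :
    sahiE (bernoulliWeight w) (k + 2)
      (fun j => ind {ω : BondConfig V | ∀ x ∈ X j, ∀ y ∈ Y j, ¬ (openGraph ω).Reachable x y}) = 0 := by
  rw [sahiE_groupSep_eq_sahiE_groupSepVia w hw X Y]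
  exact sahiE_ind_eq_zero_of_pairwise_disjoint w _ (fun j => (E ∩ edgesIn (W j)).toFinite.toFinset)
    (fun i j hij => disjoint_edgesIn_of_inter_subset hloop (hWW i j hij))
    (fun j => determinedBy_groupSepVia_lobe_toFinset (hW j) (hX j) (hY j))

/-- **Cut-terminal face (all orders).**  Let `E` be loopless with two lobes `W₁, W₂` at the vertex `b`, `W₁ ∩ W₂ ⊆ {b}`;
let `X ⊆ W₁`, `Y ⊆ W₂`, and let the `m` crossing pairs satisfy `S_j ⊆ X`, `T_j ⊆ Y`.  Then for every edge weight vanishing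
off `E`, `E_{m+2}(D[X|b], D[b|Y], D[S_1|T_1], …, D[S_m|T_m]) = 0`: the half-separations are determined by disjoint edge sets
and every crossing separation contains both (absorbing pair, `suppZeroFlag_absorbingPair`).  The family is indexed by
`Fin (m + 2)` through `Fin.cons`/`Matrix.vecCons`. [this work] -/
theorem sahiE_groupSep_cutTerminal_eq_zero (w : Sym2 V → unitInterval) {E : Set (Sym2 V)} (hloop : ∀ e ∈ E, ¬ e.IsDiag)
    (hw : ∀ e ∉ E, (w e : ℝ) = 0) {W₁ W₂ : Set V} {b : V} (h₁ : IsLobe E W₁ b) (h₂ : IsLobe E W₂ b)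
    (h12 : W₁ ∩ W₂ ⊆ {b}) (hb₁ : b ∈ W₁) (hb₂ : b ∈ W₂) {X Y : Set V} (hX : X ⊆ W₁) (hY : Y ⊆ W₂) {m : ℕ}
    (S T : Fin m → Set V) (hS : ∀ j, S j ⊆ X) (hT : ∀ j, T j ⊆ Y) :
    sahiE (bernoulliWeight w) (m + 2)
      (fun j => ind {ω : BondConfig V |
        ∀ x ∈ (Matrix.vecCons X (Matrix.vecCons {b} S) : Fin (m + 2) → Set V) j,
          ∀ y ∈ (Matrix.vecCons {b} (Matrix.vecCons Y T) : Fin (m + 2) → Set V) j,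
            ¬ (openGraph ω).Reachable x y}) = 0 := by
  rw [sahiE_groupSep_eq_sahiE_groupSepVia w hw]
  refine sahiE_ind_eq_zero_of_absorbingPair w _ ?_ fun j hj => ?_
  · -- the two half-separations live on disjoint edge sets
    refine ⟨(E ∩ edgesIn W₁).toFinite.toFinset, (E ∩ edgesIn W₂).toFinite.toFinset,
      disjoint_edgesIn_of_inter_subset hloop h12, ?_, ?_⟩
    · simpa using determinedBy_groupSepVia_lobe_toFinset h₁ hX (Set.singleton_subset_iff.2 hb₁)
    · simpa using determinedBy_groupSepVia_lobe_toFinset h₂ (Set.singleton_subset_iff.2 hb₂) hY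
  · -- slots `j ≥ 2` are crossing separations `D_E[S_i|T_i]`
    obtain ⟨i, rfl⟩ : ∃ i : Fin m, j = i.succ.succ := by
      refine ⟨⟨j.val - 2, by omega⟩, Fin.ext ?_⟩
      simp only [Fin.val_succ]
      omega
    have hTW : ∀ t ∈ T i, t ∈ W₁ → t = b := fun t ht htW => h12 ⟨htW, hY (hT i ht)⟩
    have hSW : ∀ s ∈ S i, s ∈ W₂ → s = b := fun s hs hsW => h12 ⟨hX (hS i hs), hsW⟩
    constructor
    · simpa using groupSepVia_subset_of_crossing h₁ hX (hS i) hTW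
    · simpa using groupSepVia_subset_of_crossing' h₂ hY (hT i) hSW

end Faces

end Summit.CriticalPhenomena.PercolationContinuityZ3.Theorems
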